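import Summits.ResolutionOfSingularities.ResolutionOfSingularities.Theorems.MarkedTransferCampaignW46ExitTreeMonomial
import Summits.ResolutionOfSingularities.ResolutionOfSingularities.Theorems.MarkedTransferCampaignW46ExitTreeChain
import Summits.ResolutionOfSingularities.ResolutionOfSingularities.Theorems.MarkedTransferCampaignW46ExitTreeKonig
import Summits.ResolutionOfSingularities.ResolutionOfSingularities.Theorems.ValuativeLuAlphaPTorsorCurveMonomialization
import HarnessLib

/-!
# Infinite branches of the marked quadratic tree, IV: there are none (the exit tree is finite)

[OURS · L1 W4.6 rung (i-a)′, INVARIANT layer — cell res-hironaka, LADDER-RESOLUTION rung L, D-0089; campaign s46,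
seat res-D-pv-044 AS res-L1-s46-pv-8; host route MarkedTransfer, `--supports stmt-ResolutionOfSingularities-16156
--as helper`.] HONEST FRAMING: nothing here is a statement of H. Hironaka's manuscript (2017-03-23, [Hironaka2017]);
pure commutative algebra inside a field `K`. AI-written; weaker than expert review. No `sorry`; axioms standard.
UNIVERSE: `K : Type` — the monomialization of one element along a quadratic sequence
(`PfaffLine.stub_curveMonomialization`, PROVED in the tree, `ValuativeLuAlphaPTorsorCurveMonomialization.lean`) is
stated in `Type`.

**THEOREM A (`Chain.false`, `no_infinite_markedChain`).** Let `R` be a two-dimensional regular local ring of the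
field `K = Frac R` whose one-dimensional prime quotients have finite normalisation, `J ⊆ R` an ideal and `b ≥ 1`
such that `(R, J)` is ISOLATED (no prime `q` of `R` with `J ⊆ (q^b)`). Then there is no infinite sequence of marked
steps out of `⟨R, J⟩` — no infinite chain `R = S₀ < S₁ < ⋯` of two-dimensional quadratic transforms along which the
controlled transforms `I_{i+1} = (I_i S_{i+1} : (𝔪_i S_{i+1})^b)` keep order in `[b, 2b)`. Hence
(`finite_exitTree_of_isolated`) the marked quadratic tree above `⟨R, J⟩` is FINITE and Zariski's count applies
(`sum_exitCount_lt_of_isolated`: the centre inequality of rung (i-a)′ in res-L1-s46-pv-9's currency).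

Proof (Zariski–Abhyankar): along such a chain `I_i` is eventually principal (`Chain.exists_forall_isPrincipal`), say
`I_N = (g)`; monomialize `g` along the chain (`stub_curveMonomialization`, the valuation ring of the chain being the
union of its members): at some `M ≥ N`, `g = w p^m q^n` in a regular system of parameters `(p, q)` of `S_M`, hence
(`g_M ∣ g`) `I_M = (w' p^α q^β)` with `α, β < b` (isolation propagates, `Chain.isolated`) and `b ≤ α + β < 2b`. From
a monomial node the chain cannot continue for ever (`Chain.false_of_monomial`): at the next member either `q/p` is a
unit and the controlled transform `(unit · p^{α+β-b})` has order `< b`, or `(p, q/p)` is a regular system of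
parameters and the shape persists with `α + β` replaced by `α + 2β - b < α + β`.

## References

* O. Zariski, P. Samuel, *Commutative Algebra* II (1960), Appendix 5. [ZariskiSamuel1960]
* S. S. Abhyankar, *On the valuations centered in a local domain*, Amer. J. Math. 78 (1956). [Abhyankar1956Valuations]
-/

noncomputable section

open IsLocalRing

-- single-problem summit: the doubled namespace component `ResolutionOfSingularities` is forced
set_option linter.dupNamespace false

namespace Summit.ResolutionOfSingularities.ResolutionOfSingularities.Theorems.CampaignW46

open Literature.AlgebraicGeometry.Resolution
open Summit.ResolutionOfSingularities.ResolutionOfSingularities.Theorems.PfaffLine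

variable {K : Type} [Field K] {b : ℕ}

namespace Chain

variable {c : ℕ → MarkedNode K} (hc : ∀ i, MarkedStep b (c i) (c (i + 1)))
include hc

/-- **Telescoping between two members**: `I_i S_j = a · I_j` for some `a ≠ 0` (`i ≤ j`). [folklore] -/
theorem extIdeal_snd_le {i j : ℕ} (hij : i ≤ j) :
    ∃ a : (c j).1, a ≠ 0 ∧ extIdeal (c i).2 (c j).1 = Ideal.span {a} * (c j).2 := by
  induction hij with
  | refl =>
    refine ⟨1, one_ne_zero, ?_⟩
    rw [Ideal.span_singleton_one, Ideal.top_mul, extIdeal_eq_map _ le_rfl]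
    have : Subring.inclusion (le_refl (c i).1) = RingHom.id _ := RingHom.ext fun _ => rfl
    rw [this, Ideal.map_id]
  | @step j hij ih =>
    obtain ⟨a, ha0, ha⟩ := ih
    obtain ⟨x, hxS, hx0, -, -, hxm⟩ := exists_chart hc j
    have hx : x ∈ (c (j + 1)).1 := le_succ hc j hxS
    have hstep := extIdeal_snd_succ hc j hx (hxm hx)
    have hij' : (c i).1 ≤ (c j).1 := monotone hc hij
    refine ⟨Subring.inclusion (le_succ hc j) a * (⟨x, hx⟩ : (c (j + 1)).1) ^ b, ?_, ?_⟩
    · refine mul_ne_zero ?_ (pow_ne_zero _ fun e => hx0 (congrArg Subtype.val e))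
      intro e
      exact ha0 (Subtype.ext (congrArg (fun z : (c (j + 1)).1 => (z : K)) e))
    · rw [← map_extIdeal (c i).2 hij' (le_succ hc j), ha, Ideal.map_mul, Ideal.map_span, Set.image_singleton,
        ← extIdeal_eq_map _ (le_succ hc j), hstep, ← mul_assoc, Ideal.span_singleton_mul_span_singleton]

/-- **One monomial step of the descent, on the chart of `p`.** If `I_i = (w p^α q^β)` in a regular system of
parameters `(p, q)` of `S_i` (`w` a unit, `β < b ≤ α + β < 2b`) and `S_{i+1} ⊇ S_i[q/p]`, then `I_{i+1}` is again a
monomial `(w' p'^{α+β-b} q'^β)` in a regular system of parameters of `S_{i+1}` — the point `q/p ∈ 𝔪_{i+1}` being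
forced by `I_{i+1} ⊆ 𝔪_{i+1}^b`. [cite: ZariskiSamuel1960, Appendix 5] -/
theorem monomial_descent (i : ℕ) {p q w : (c i).1} {α β : ℕ}
    (hm : haveI := (isRegularLocalRing hc i).toIsLocalRing; maximalIdeal (c i).1 = Ideal.span {p, q})
    (hw : IsUnit w) (hI : (c i).2 = Ideal.span {w * p ^ α * q ^ β}) (hp0 : p ≠ 0)
    (hbn : b ≤ α + β) (h2b : α + β < 2 * b)
    (hle : chartAdjoin (K := K) p q ≤ (c (i + 1)).1) :
    ∃ (p' q' w' : (c (i + 1)).1),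
      (haveI := (isRegularLocalRing hc (i + 1)).toIsLocalRing; maximalIdeal (c (i + 1)).1 = Ideal.span {p', q'}) ∧
      IsUnit w' ∧ (c (i + 1)).2 = Ideal.span {w' * p' ^ (α + β - b) * q' ^ β} := by
  haveI := isRegularLocalRing hc i
  haveI := isRegularLocalRing hc (i + 1)
  have hdim := ringKrullDim_eq hc i
  have hd' := ringKrullDim_eq hc (i + 1)
  have h₁ := isQuadraticTransform hc i
  have hSS' : (c i).1 ≤ (c (i + 1)).1 := (subring_le_adjoin (c i).1 _).trans hle
  have ht : ((q : (c i).1) : K) / ((p : (c i).1) : K) ∈ (c (i + 1)).1 :=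
    hle (Algebra.self_mem_adjoin_singleton (c i).1 _)
  set p' : (c (i + 1)).1 := Subring.inclusion hle (chartIncl p q p) with hp'def
  set t' : (c (i + 1)).1 := ⟨((q : (c i).1) : K) / ((p : (c i).1) : K), ht⟩ with ht'def
  set w' : (c (i + 1)).1 := Subring.inclusion hSS' w with hw'def
  have hw' : IsUnit w' := hw.map _
  have hI' : (c (i + 1)).2 = Ideal.span {w' * p' ^ (α + β - b) * t' ^ β} := by
    rw [snd_succ hc i, hI]
    exact ctrlTransform_monomial_chart hm hp0 hbn hle ht
  by_cases htm : t' ∈ maximalIdeal (c (i + 1)).1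
  · -- corner point: `(p', t')` is a regular system of parameters
    exact ⟨p', t', w', maximalIdeal_eq_span_pair_of_div_mem hm hp0 h₁ hle ht htm, hw', hI'⟩
  · -- free point: the order of `I_{i+1}` is `α + β - b < b`, contradicting singularity
    exfalso
    have htu : IsUnit t' := IsLocalRing.notMem_maximalIdeal.mp htm
    obtain ⟨f, hm'⟩ := exists_maximalIdeal_eq_span_pair_of_isQuadraticTransform hm hp0 h₁ hle
    have hsing := snd_le_pow hc (i + 1)
    rw [hI', show w' * p' ^ (α + β - b) * t' ^ β = (w' * t' ^ β) * p' ^ (α + β - b) * f ^ 0 by ring,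
      span_monomial_le_pow_iff hd' hm' (hw'.mul (htu.pow β))] at hsing
    omega

/-- **The monomial descent**: no infinite chain passes through a node whose marked ideal is a monomial
`(w p^α q^β)` in a regular system of parameters — by induction on `α + β`. [cite: ZariskiSamuel1960, Appendix 5] -/
theorem false_of_monomial (hiso : ∀ q : (c 0).1, Prime q → ¬ (c 0).2 ≤ Ideal.span {q ^ b}) :
    ∀ (n i : ℕ) (p q w : (c i).1) (α β : ℕ),
      (haveI := (isRegularLocalRing hc i).toIsLocalRing; maximalIdeal (c i).1 = Ideal.span {p, q}) →
      IsUnit w → (c i).2 = Ideal.span {w * p ^ α * q ^ β} → α + β = n → False := by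
  intro n
  induction n using Nat.strong_induction_on with
  | _ n ih =>
  intro i p q w α β hm hw hI hn
  haveI := isRegularLocalRing hc i
  have hdim := ringKrullDim_eq hc i
  have hm' : maximalIdeal (c i).1 = Ideal.span {q, p} := by rw [hm, Set.pair_comm]
  have hpm : p ∈ maximalIdeal (c i).1 := hm ▸ Ideal.subset_span (by simp)
  have hqm : q ∈ maximalIdeal (c i).1 := hm ▸ Ideal.subset_span (by simp)
  have hp : Prime p := IsRegularLocalRing.prime_of_not_mem_sq hpm (fst_not_mem_sq hdim hm)
  have hq : Prime q := IsRegularLocalRing.prime_of_not_mem_sq hqm (fst_not_mem_sq hdim hm')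
  have hI' : (c i).2 = Ideal.span {w * q ^ β * p ^ α} := by rw [hI, mul_right_comm]
  -- exponents: `α, β < b` (isolation), `b ≤ α + β < 2b` (singular and tame)
  have hisoi := isolated hc hiso i
  have hαb : α < b := lt_of_span_monomial_not_le (hI ▸ hisoi p hp)
  have hβb : β < b := lt_of_span_monomial_not_le (hI' ▸ hisoi q hq)
  have hbn : b ≤ α + β := by
    have := snd_le_pow hc i
    rw [hI, span_monomial_le_pow_iff hdim hm hw] at this
    exact this
  have h2b : α + β < 2 * b := by
    have := snd_not_le_pow hc i
    rw [hI, span_monomial_le_pow_iff hdim hm hw] at this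
    omega
  -- the chart containing `S_{i+1}`
  rcases (isQuadraticTransform hc i).blowupRing_le_or hm with hX | hY
  · have hle : chartAdjoin (K := K) p q ≤ (c (i + 1)).1 := (blowupRing_eq_adjoin (K := K) hm).symm.le.trans hX
    obtain ⟨p', q', w', hm'', hw', hI''⟩ := monomial_descent hc i hm hw hI hp.ne_zero hbn h2b hle
    exact ih (α + β - b + β) (by omega) (i + 1) p' q' w' (α + β - b) β hm'' hw' hI'' rfl
  · have hle : chartAdjoin (K := K) q p ≤ (c (i + 1)).1 := (blowupRing_eq_adjoin (K := K) hm').symm.le.trans hY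
    obtain ⟨p', q', w', hm'', hw', hI''⟩ :=
      monomial_descent hc i hm' hw hI' hq.ne_zero (by omega) (by omega) hle
    exact ih (β + α - b + α) (by omega) (i + 1) p' q' w' (β + α - b) α hm'' hw' hI'' rfl

/-- **THEOREM A: there is no infinite chain of marked steps out of an isolated node** (whose ring has Japanese
one-dimensional prime quotients). [cite: ZariskiSamuel1960, Appendix 5] -/
theorem false (hiso : ∀ q : (c 0).1, Prime q → ¬ (c 0).2 ≤ Ideal.span {q ^ b})
    (hfin : ∀ (𝔮 : Ideal (c 0).1) (L : Type) [Field L] [Algebra ((c 0).1 ⧸ 𝔮) L]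
      [IsFractionRing ((c 0).1 ⧸ 𝔮) L], 𝔮.IsPrime → ringKrullDim ((c 0).1 ⧸ 𝔮) = 1 →
        Module.Finite ((c 0).1 ⧸ 𝔮) (integralClosure ((c 0).1 ⧸ 𝔮) L)) : False := by
  classical
  haveI := fun i => isRegularLocalRing hc i
  obtain ⟨W, hdom, halong, -⟩ := exists_valuationSubring hc
  obtain ⟨N, hN⟩ := exists_forall_isPrincipal hc
  -- a generator `g` of `I_N`
  haveI hNp := hN N le_rfl
  set g : (c N).1 := Submodule.IsPrincipal.generator (c N).2 with hgdef
  have hIg : (c N).2 = Ideal.span {g} := (Ideal.span_singleton_generator _).symm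
  have hg0 : g ≠ 0 := by
    intro h0
    apply snd_not_le_pow hc N
    rw [hIg, h0, Ideal.span_singleton_zero]
    exact bot_le
  have hg0K : (g : K) ≠ 0 := fun e => hg0 (Subtype.ext e)
  -- monomialize `g` along the chain
  obtain ⟨M, hNM, d, u, Mv, w, hw, hspan, hdimd, hgK⟩ :=
    stub_curveMonomialization K W (fun i => (c i).1) (isRegularLocalRing hc 0) (ringKrullDim_eq hc 0)
      (isLocalRingOf hc 0) (hdom 0) halong hfin N (g : K) g.2 hg0K
  have hd2 : d = 2 := by
    have := (ringKrullDim_eq hc M).symm.trans hdimd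
    exact_mod_cast this.symm
  subst hd2
  set p : (c M).1 := u 0 with hpdef
  set q : (c M).1 := u 1 with hqdef
  have hdimM := ringKrullDim_eq hc M
  have hm : maximalIdeal (c M).1 = Ideal.span {p, q} := by
    have hr : Set.range u = {p, q} := by
      ext a
      simp only [Set.mem_range, Set.mem_insert_iff, Set.mem_singleton_iff, Fin.exists_fin_two, eq_comm, hpdef, hqdef]
    rw [← hr]
    ext z
    rw [hspan z, IsLocalRing.mem_maximalIdeal, mem_nonunits_iff]
  have hpm : p ∈ maximalIdeal (c M).1 := hm ▸ Ideal.subset_span (by simp)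
  have hqm : q ∈ maximalIdeal (c M).1 := hm ▸ Ideal.subset_span (by simp)
  have hp : Prime p := IsRegularLocalRing.prime_of_not_mem_sq hpm (fst_not_mem_sq hdimM hm)
  have hq : Prime q := IsRegularLocalRing.prime_of_not_mem_sq hqm (snd_not_mem_sq hdimM hm)
  -- `I_M = (g_M)` with `g_M ∣ g = w p^{m} q^{n}`
  haveI hMp := hN M hNM
  set gM : (c M).1 := Submodule.IsPrincipal.generator (c M).2 with hgMdef
  have hIgM : (c M).2 = Ideal.span {gM} := (Ideal.span_singleton_generator _).symm
  have hNM' : (c N).1 ≤ (c M).1 := monotone hc hNM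
  have hgE : Subring.inclusion hNM' g ∈ extIdeal (c N).2 (c M).1 := by
    rw [extIdeal_eq_map _ hNM']
    exact Ideal.mem_map_of_mem _ (hIg ▸ Ideal.mem_span_singleton_self g)
  obtain ⟨a, -, ha⟩ := extIdeal_snd_le hc hNM
  rw [ha, hIgM, Ideal.span_singleton_mul_span_singleton, Ideal.mem_span_singleton] at hgE
  have hgmono : Subring.inclusion hNM' g = w * p ^ Mv 0 * q ^ Mv 1 := by
    apply Subtype.ext
    change (g : K) = ((w : (c M).1) : K) * ((p : (c M).1) : K) ^ Mv 0 * ((q : (c M).1) : K) ^ Mv 1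
    rw [hgK, Fin.prod_univ_two]
    ring
  have hdvd : gM ∣ w * p ^ Mv 0 * q ^ Mv 1 := hgmono ▸ (Dvd.intro_left _ rfl |> fun h => dvd_trans h hgE)
  obtain ⟨α, β, w', hw', -, -, hgM⟩ := exists_eq_unit_mul_pow_mul_pow_of_dvd hp hq hw _ _ gM hdvd
  exact false_of_monomial hc hiso (α + β) M p q w' α β hm hw' (by rw [hIgM, hgM]) rfl

end Chain

/-! ## Finiteness of the exit tree and the centre inequality -/

/-- **There is no infinite sequence of marked steps out of an isolated node** (Theorem A in the currency of
`finite_exitTree_of_no_infinite_branch`). [cite: ZariskiSamuel1960, Appendix 5] -/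
theorem no_infinite_markedChain {S : Subring K} {J : Ideal S}
    (hiso : ∀ q : S, Prime q → ¬ J ≤ Ideal.span {q ^ b})
    (hfin : ∀ (𝔮 : Ideal S) (L : Type) [Field L] [Algebra (S ⧸ 𝔮) L] [IsFractionRing (S ⧸ 𝔮) L],
      𝔮.IsPrime → ringKrullDim (S ⧸ 𝔮) = 1 → Module.Finite (S ⧸ 𝔮) (integralClosure (S ⧸ 𝔮) L))
    (c : ℕ → MarkedNode K) (h0 : c 0 = ⟨S, J⟩) (hc : ∀ i, MarkedStep b (c i) (c (i + 1))) : False := by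
  -- re-root the chain definitionally at `⟨S, J⟩`
  let c' : ℕ → MarkedNode K := fun i => match i with
    | 0 => ⟨S, J⟩
    | j + 1 => c (j + 1)
  have hc' : ∀ i, MarkedStep b (c' i) (c' (i + 1)) := by
    intro i
    cases i with
    | zero =>
      have := hc 0
      rw [h0] at this
      exact this
    | succ j => exact hc (j + 1)
  exact Chain.false (c := c') hc' hiso hfin

/-- **The marked quadratic tree above an isolated node is finite.** [cite: ZariskiSamuel1960, Appendix 5] -/
theorem finite_exitTree_of_isolated {S : Subring K} {J : Ideal S}
    (hiso : ∀ q : S, Prime q → ¬ J ≤ Ideal.span {q ^ b})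
    (hfin : ∀ (𝔮 : Ideal S) (L : Type) [Field L] [Algebra (S ⧸ 𝔮) L] [IsFractionRing (S ⧸ 𝔮) L],
      𝔮.IsPrime → ringKrullDim (S ⧸ 𝔮) = 1 → Module.Finite (S ⧸ 𝔮) (integralClosure (S ⧸ 𝔮) L)) :
    (exitTree b (⟨S, J⟩ : MarkedNode K)).Finite :=
  finite_exitTree_of_no_infinite_branch _ fun c h0 hc => no_infinite_markedChain hiso hfin c h0 hc

/-- **The centre inequality of rung (i-a)′ (surface case), unconditional form.** At a tame isolated node `⟨S, J⟩`
(`S` a two-dimensional regular local ring of `K : Type` with Japanese one-dimensional prime quotients,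
`J ⊆ 𝔪^b`, `J ⊄ 𝔪^{2b}`, no prime `q` with `J ⊆ (q^b)`), for every finite set `F` of distinct two-dimensional
first quadratic transforms `S'` of `S`: `∑_{S' ∈ F} ν(S', (J S' : (𝔪 S')^b), b) < ν(S, J, b)`.
[cite: ZariskiSamuel1960, Appendix 5] -/
theorem sum_exitCount_lt_of_isolated {S : Subring K} [IsRegularLocalRing S] {J : Ideal S}
    (hS : IsTameNode b (⟨S, J⟩ : MarkedNode K))
    (hiso : ∀ q : S, Prime q → ¬ J ≤ Ideal.span {q ^ b})
    (hfin : ∀ (𝔮 : Ideal S) (L : Type) [Field L] [Algebra (S ⧸ 𝔮) L] [IsFractionRing (S ⧸ 𝔮) L],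
      𝔮.IsPrime → ringKrullDim (S ⧸ 𝔮) = 1 → Module.Finite (S ⧸ 𝔮) (integralClosure (S ⧸ 𝔮) L))
    (F : Finset (Subring K)) (hF : ∀ S' ∈ F, IsQuadraticTransform S S' ∧ ringKrullDim S' = 2) :
    ∑ S' ∈ F, exitCount b S' (ctrlTransform b S J S') < exitCount b S J :=
  sum_exitCount_lt hS (finite_exitTree_of_isolated hiso hfin) F hF

end Summit.ResolutionOfSingularities.ResolutionOfSingularities.Theorems.CampaignW46

end
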